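import Mathlib
import HarnessLib
import HarnessLib.Audit
import Summits.Parity.Statement
import Literature.NumberTheory.EllipticCurves.BSDSelmer

/-!
Route: SelmerParityReverse

CLOSED (retired) 2026-08-15T13:50:34Z by operator:999:1257524 — reason: not-a-thesis: assembly does not conclude the sub-problem Statement — note: D-0027 §2.1 audit (human 2026-08-15: routes that do not decide the summit are removed): the assembly concludes `Literature.NumberTheory.Sieve.HardyLittlewoodConjE`, not the sub-problem statement; a NEW conforming route may be opened from the same idea (generated `closes : … → _root_.BatemanHorn`).. The file is kept as the record of this route; refuted decls are indexed as negative knowledge (`ledger negatives`).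

# Route SelmerParityReverse — Chowla for t²+1 is Selmer-parity equidistribution on the pencil
y²=x³+2tx²−x — run the 2-parity dictionary in reverse

Realises card Parity/BatemanHorn/selmer-parity-reverse on ONE explicit pencil: 𝓔_t : y² = x³ + 2t·x²
− x (t ∈ ℕ, t ≥ 1), Δ(𝓔_t) = 64(t²+1),
c₄ = 16(4t²+3): multiplicative reduction exactly at the odd primes p ∣ t²+1 (type I_v, v =
v_p(t²+1); split iff (t|p) = 1), additive at 2, so
M_𝓔 = t²+1 in Helfgott's notation. It suffices to show X = X_S ∧ X_D: (X_D, RootNumberDictionary)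
w(𝓔_t) = g(t)·ε(t)·λ(t²+1) for all t ≥ 1 with g
PERIODIC and ε(t) := ∏_{p odd, p^v ∥ t²+1} (−1)^{v+1}(t|p)^{v−1} (= 1 unless p² ∣ t²+1: the tame
correction at non-reduced multiplicative fibres);
(X_S, SelmerParityLevel) the ε-normalised 2^∞-Selmer parity (−1)^{corank Sel_2∞(𝓔_t)}·ε(t) has level
of distribution x^{1−η} (every η > 0)
along the multiplicative fibres t ≡ ρ (mod m), m ∣ ρ²+1, m ≤ x^{1−η}. By the 2-parity theorem
(Literature fact p_parity, Dokchitser–Dokchitser)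
X gives Liouville randomness of t²+1 along root classes at level x^{1−η} — exactly the cofactor
input of the n²+1 sieve — and with the sub-dyadic
parity window (WindowWSub), Type I and the PNT(ℚ(i)) singular-series inputs, Hardy–Littlewood's
Conjecture E (the n²+1 case of BatemanHorn).
Lean: `(∀ q₀ b : ℕ, 0 < q₀ → ∀ η : ℝ, 0 < η → η < 1 → ∀ A : ℝ, 0 < A → ∃ x₀ : ℕ, ∀ x : ℕ, x₀ ≤ x → ∀
y : ℕ → ℕ → ℕ, (∀ m ρ, y m ρ ≤ x) → ∑ m ∈ Finset.Icc 1 ⌊(x : ℝ) ^ (1 - η)⌋₊, ∑ ρ ∈ (Finset.range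
m).filter (fun ρ => m ∣ ρ ^ 2 + 1), |∑ t ∈ (Finset.Icc 1 (y m ρ)).filter (fun t => t ≡ ρ [MOD m] ∧ t
≡ b [MOD q₀]), (((∏ p ∈ (t ^ 2 + 1).primeFactors.erase 2, (-1 : ℤ) ^ (padicValNat p (t ^ 2 + 1) + 1)
* jacobiSym (t : ℤ) p ^ (padicValNat p (t ^ 2 + 1) - 1)) * (-1 : ℤ) ^ (WeierstrassCurve.selmerCorank
(⟨0, 2 * (t : ℚ), 0, -1, 0⟩ : WeierstrassCurve ℚ) 2) : ℤ) : ℝ)| ≤ (x : ℝ) / Real.log x ^ A) ∧ (∃ q :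
ℕ, 0 < q ∧ ∃ g : ℕ → ℤ, (∀ t, g (t + q) = g t) ∧ (∀ t, g t = 1 ∨ g t = -1) ∧ ∀ t : ℕ, 1 ≤ t →
WeierstrassCurve.rootNumber (⟨0, 2 * (t : ℚ), 0, -1, 0⟩ : WeierstrassCurve ℚ) = g t * (∏ p ∈ (t ^ 2
+ 1).primeFactors.erase 2, (-1 : ℤ) ^ (padicValNat p (t ^ 2 + 1) + 1) * jacobiSym (t : ℤ) p ^
(padicValNat p (t ^ 2 + 1) - 1)) * (-1 : ℤ) ^ (ArithmeticFunction.cardFactors (t ^ 2 + 1)))`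

## Assembly
Pure logic from the two glue supports (checked sorry-free in the planner's Sketch.lean: `fun hS hD
hP hW hT hN hE => LiouvilleToHLE (SelmerToLiouville hS hD hP) hW hT hN hE`):
the Selmer cruxes r2, r4 and the 2-parity fact give LiouvilleRootClassLevel; with the window r5,
Type I, the singular-series inputs and the
Conjecture-E Euler-product fact, LiouvilleToHLE yields HardyLittlewoodConjE, the X²+1 conjunct of
BatemanHorn (as in routes QuadraticRoots /
SelbergDelange / UnimodularColumns; general f needs a pencil with M_𝓔 = f and is not decomposed).
The 2-parity theorem enters as the hypothesis
`∀ W [W.IsElliptic] p [Fact p.Prime], p_parity W p` (named Literature fact, Dokchitser–Dokchitser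
2010 Thm 1.4), exactly as in
Literature.NumberTheory.EllipticCurves.BSDRankZeroAssembly.

Rationale: WHY THIS LINE. Helfgott proved W(𝓔(t)) = g(t)·h(sq(B′(t)),t)·λ(M_𝓔(t)) with g pliable
(Helfgott2003RootNumbers Prop. 5.4, Lemma 5.2–5.3) and used Chowla(M_𝓔) ⇒ av W = 0
(Thm. 7.1); the 2-parity theorem (DokchitserDokchitserAnnals2010 Thm 1.4, Monsky1996;
Literature.NumberTheory.EllipticCurves.p_parity) makes
(−1)^{corank Sel_2∞(𝓔_t)} = W(𝓔_t) unconditional, so for this pencil polynomial Chowla for t²+1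
(open since Chowla1965; Teravainen2024 Conj. 1.2) IS a
statement about the distribution of a GLOBAL arithmetic invariant of one elliptic surface; the route
runs the dictionary in reverse and stakes the
attack on Selmer-side technology that never evaluates local constants: counting 2-coverings =
locally soluble binary quartics with invariants
(I(t),J(t)) (BhargavaShankarAnnals2015; Literature BinaryQuartic*/BhargavaShankar* files), parity as
relative position of global and adelic
Lagrangians (PoonenRains2012), Smith-type 2^∞-Selmer laws (arXiv:2503.17619). Imported area:
arithmetic of elliptic curves (descent, geometry of numbers
on coregular spaces) into the parity problem for one polynomial. The pencil is chosen so that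
everything is explicit and typed: w_p = −(t|p) at p ∣ t²+1,
∏_p (t|p)^{v_p} is periodic mod 8 (quadratic reciprocity; checked numerically t ≤ 4000), W_2 is
periodic by local constancy + compactness of ℤ₂
(Helfgott2004RootNumberFamilies Prop. 4.2–4.3), hence g is periodic, not merely pliable. Known trap
recorded up front: for the rational 2-isogeny of
𝓔_t the isogeny-Selmer group Sel^φ contains every positive odd squarefree d ∣ t²+1 (C_d: d₁w² =
(2d₁z²−t)²+1 is everywhere locally soluble), so the
isogeny-torsor count is the divisor function of t²+1 and its parity is λ by fiat — the engine must
see the FULL 2-Selmer group / Ш[2], not Sel^φ.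
No prior BatemanHorn route (PolynomialMobius, QuadraticRoots, UnimodularColumns, SelbergDelange,
CubicRoots, MinorArcs, AsymptoticSieve) uses an
object from outside multiplicative/harmonic analysis for the parity atom; negatives index empty at
filing.

RANKED CRUXES. #0 Target (target) — X = SelmerParityLevel ∧ RootNumberDictionary (X_S ∧ X_D of the
Thesis). (why it might fail: X_S is Chowla-in-APs for t²+1 at Elliott–Halberstam-range level in
Selmer clothing; every unconditional Selmer-parity law in families so far factors through local root
numbers (circularity), and the pencil is a thin (codimension-2) family in quartic-invariant space.)
[Helfgott2003RootNumbers, DokchitserDokchitserAnnals2010, BhargavaShankarAnnals2015,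
arXiv:2503.17619, Teravainen2024]
#2 SelmerParityLevel (crux) — for every fixed auxiliary class t ≡ b (mod q₀), every η ∈ (0,1) and A
> 0, for x ≥ x₀: Σ_{m ≤ x^{1−η}} Σ_{ρ mod m, m∣ρ²+1} max_{y ≤ x} |Σ_{t ≤ y, t≡ρ (m), t≡b (q₀)}
ε(t)(−1)^{corank Sel_2∞(𝓔_t)}| ≤ x/(log x)^A — the ε-normalised Selmer parity of the pencil is
equidistributed along its multiplicative fibres (m ∣ t²+1 ⇔ 𝓔_t multiplicative at all p ∣ m),
uniformly for conductor-parts m ≤ x^{1−η} (card C1+C2, level form needed by the assembly).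
[difficulty: open-problem] (why it might fail: Equivalent (given r4 + 2-parity) to level-(1−η)
equidistribution of λ(t²+1) on root classes: parity atom AND EH-range uniformity in m
(LargeSieveLevelHalf); known Selmer laws (Heath-Brown, Kane, Smith, Bhargava–Shankar) need large
families and compute parity locally.) [Helfgott2003RootNumbers, DokchitserDokchitserAnnals2010,
BhargavaShankarAnnals2015, PoonenRains2012, arXiv:2503.17619,
Literature.Barriers.Parity.LargeSieveLevelHalf]
#3 SelmerParityAtom (crux) — for every q ≥ 1 and a: Σ_{t ≤ x, t ≡ a (q), t²+1 squarefree}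
(−1)^{corank Sel_2∞(𝓔_t)} = o(x) — 2^∞-Selmer parity (equivalently rank parity given Ш(𝓔_t)[2^∞]
finite, or dim Sel₂(𝓔_t) − 1 mod 2 by Cassels–Tate) of the pencil is equidistributed in every
arithmetic progression of squarefree fibres; by r4 + 2-parity this is literally Σ_{t≡a (q)} μ(t²+1)
= o(x) for all q, a (the Möbius atom of n²+1 in APs, cf. stmt-Parity-0650 e = 1 and
stmt-Parity-0615): the card's headline equivalence, the first target for any torsor-counting engine
and the cheapest statement to test. [difficulty: open-problem] (why it might fail: As a Möbius
statement it is polynomial Chowla for (qm+a)²+1, open for every nonlinear polynomial (Teravainen2024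
Conj. 1.2); as a Selmer statement no root-number-free evaluation of parity in a thin pencil is known
— a grounder may show every available formula is Cassels/DD-local, i.e. circular.) [Teravainen2024,
Chowla1965, Helfgott2003RootNumbers, DokchitserDokchitserAnnals2010, Monsky1996, PoonenRains2012]
#4 RootNumberDictionary (crux) — there are q ≥ 1 and a q-periodic g : ℕ → {±1} with w(𝓔_t) =
g(t)·ε(t)·λ(t²+1) for all t ≥ 1 (Helfgott's Prop. 5.4 made explicit for the pencil: w_∞ = −1; w_p =
−(t|p) at odd p ∣ t²+1 since the node of y² = x(x+t)² mod p has tangent cone y² = −tX² and p ≡ 1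
(4); ∏_p (t|p)^{v_p(t²+1)} depends on t mod 8; w_2(𝓔_t) depends on t mod 2^K because v₂(Δ) ∈ {6,7}
is bounded and local root numbers are locally constant 2-adically). [difficulty: M] (why it might
fail: PERIODICITY of g is the bet: Helfgott's g is only pliable (may depend on v₂(t)); here v₂(c₆) =
6+v₂(t) is unbounded while v₂(Δ) ≤ 7, and w₂ must be read off Kellock–Dokchitser's ℚ₂ tables — a
slip there or in the split criterion flips signs (PARI ellrootno settles it).)
[Helfgott2003RootNumbers, Helfgott2004RootNumberFamilies, Rohrlich1993Compositio,
KellockDokchitser2023, Literature.NumberTheory.EllipticCurves.exists_local_tables_two_three]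
#5 WindowWSub (crux) — SUB-DYADIC parity window for n²+1: ∃ η > 0 ∀ A: for all large x and x^{1−η} ≤
D ≤ D′ ≤ 2D, D ≤ x^{1+η}: |Σ_{D<d≤D′} μ(d)(#{n ≤ x : d ∣ n²+1} − x·ω(d)/d)| ≤ x/(log x)^A (ω =
polyRootCountMod (X²+1)); D′ = 2D is QuadraticRoots' (W) = stmt-Parity-0648, and the sub-dyadic form
is what partial summation of the log-weights actually needs (refuter note g2-1 on stmt-Parity-0647).
[difficulty: open-problem] (why it might fail: For d > x it is μ(d) against counts of SMALL roots ν
≤ x of ν² ≡ −1 (d): Type-II information for A_{mn} in print stops at n < x^{1/3} (arXiv:2505.00493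
Thm 1.5; Merikoski2022 Prop. 4); the balanced range mn ~ x is the spectral method's diagonal.)
[Merikoski2022, arXiv:2505.00493, DukeFriedlanderIwaniec1995, Hooley1976, stmt-Parity-0648]
#9 LiouvilleRootClassLevel (support) — λ-side junction (implied by r2 ∧ r4 ∧ 2-parity via
SelmerToLiouville; stated separately so that the bookkeeping item is purely λ-side): ∀ η ∈ (0,1) ∀
A: Σ_{m ≤ x^{1−η}} Σ_{ρ mod m, m∣ρ²+1} max_{y≤x} |Σ_{t ≤ y, t ≡ ρ (m)} λ(t²+1)| ≤ x/(log x)^A for x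
≥ x₀. Itself open (contains Σ λ(n²+1) = o(x), Chowla 1965; Helfgott's Hypothesis 𝔅₁(t²+1) is its
level-(log x)^A case). [difficulty: open-problem] [Chowla1965, Teravainen2024,
Helfgott2003RootNumbers, stmt-Parity-0649]
#9 QrootsTypeIT1 (support) — (T1), shared verbatim with QuadraticRoots (stmt-Parity-0651): Σ_{d ≤
x^{1−ε}} |#{n ≤ x : d ∣ n²+1} − x ω(d)/d| ≪ x/(log x)^A (each remainder is O(ω(d)); Σ_{d≤D} ω(d) ≪ D
log D). [difficulty: provable-now] [Hooley1976, stmt-Parity-0651]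
#9 SingularSeriesPNT (support) — the two PNT(ℚ(i))-grade singular-series inputs the bookkeeping
needs and QuadraticRoots left implicit (refuter note g2-7 on stmt-Parity-0647): (a) Σ_{d≤D}
μ(d)ω(d)/d ≪_A (log D)^{−A}; (b) Σ_{d≤D} μ(d)ω(d) log d/d → −𝔖, 𝔖 = hardyLittlewoodEConst = ∏_p
(1−ω(p)/p)(1−1/p)^{−1} (Dirichlet series ∏_p(1 − ω(p)p^{−1−s}) ~ s·𝔖 at s = 0; zero-free region of
ζ_{ℚ(i)}). [difficulty: L] [BatemanHorn1962, Hooley1976,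
Literature.NumberTheory.Sieve.tendsto_hardyLittlewoodE_partial]
#9 SelmerToLiouville (support) — glue, provable now: SelmerParityLevel → RootNumberDictionary →
(2-parity for all E/ℚ, the Literature fact p_parity as hypothesis) → LiouvilleRootClassLevel. Proof:
Δ(𝓔_t) = 64(t²+1) ≠ 0 gives IsElliptic; λ(t²+1) = g(t)·ε(t)·(−1)^{corank} (all factors ±1); split t
by its class b mod q (period of g), apply r2 with (q₀,b) = (q,b) and η/2, sum the q bounds.
[difficulty: provable-now] [DokchitserDokchitserAnnals2010, Helfgott2003RootNumbers]
#9 LiouvilleToHLE (support) — λ-side bookkeeping, provable with effort: LiouvilleRootClassLevel →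
WindowWSub → QrootsTypeIT1 → SingularSeriesPNT → tendsto_hardyLittlewoodE_partial →
HardyLittlewoodConjE. Σ_{n≤x} Λ(n²+1) = −Σ_n Σ_{d∣n²+1} μ(d) log d; d ≤ x^{1−η}: (T1) +
SingularSeriesPNT(b) give 𝔖x + o(x); x^{1−η} < d ≤ x^{1+η}: WindowWSub with log d by partial
summation inside each dyadic block plus SingularSeriesPNT(a) for the main terms; d > x^{1+η} ⇔ e =
(n²+1)/d < x^{1−η}: μ(d) = λ(e)λ(n²+1)·Σ_{r²∣d} μ(r) (λ completely multiplicative), r ≤ x^{η/4}: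
root classes mod e·r² ≤ x^{1−η/2} with the length cut n² + 1 > e x^{1+η} absorbed by max_y —
LiouvilleRootClassLevel at η/2 once per r; r > x^{η/4}: ≤ x^ε·#{n ≤ x : ∃ r > x^{η/4}, r² ∣ n²+1} ≪
x^{1−η/5} (Estermann: Σ_{r ≤ x^{2/3}}(xω(r²)/r² + ω(r²)) + O(log x) Pell solutions per c ≤ x^{2/3});
then prime powers n²+1 = p^k, k ≥ 3, are O(x^{2/3}), partial summation to the count,
HardyLittlewoodConjE.isEquivalent-form with 𝔖. [difficulty: L] [Hooley1976, BatemanHorn1962,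
stmt-Parity-0647]

TWO-LAYER PLAN. Foreseen glued splits (none filed now): SelmerParityLevel ⇐ SelmerParityAtom-type
equidistribution on each fixed fibre class → a transfer lemma
raising fixed-modulus equidistribution to level x^{1/2−η} (large-sieve range) → the EH-range piece m
∈ (x^{1/2}, x^{1−η}] (which by divisor
switching is a window statement for d ∈ [x^{1+η}, x^{3/2}] and may migrate to r5); SelmerParityAtom
⇐ [a root-number-free formula for the parity
of dim Sel₂(𝓔_t): signed count of GL₂(ℤ)-classes of locally soluble quartics with invariants
(I(t),J(t)), or the O/SO-component of the pair of
Lagrangians à la Poonen–Rains] → [equidistribution of that count along t by geometry of numbers on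
the invariant curve]; RootNumberDictionary ⇐
[odd places: w_p = −(t|p), reciprocity] → [w₂ periodic: Kellock–Dokchitser table or local constancy
+ compactness] → [w = −∏ w_v: exists_local_tables_two_three].

KILL CRITERIA. RootNumberDictionary refuted by a sign pattern that is pliable but NOT periodic
(dependence on v₂(t)) ⇒ restate r4/r2 with g affinely pliable at 0 in ℤ₂
(pivot, same assembly); refuted at an odd place ⇒ my split/non-split computation is wrong ⇒
re-derive ε (pivot). SelmerParityAtom refuted (a bias of
Selmer parity = a bias of μ(t²+1) in some AP, e.g. a CCG-type phenomenon over ℤ) ⇒ ¬PolyMobiusAtom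
for a quadratic ⇒ close `refuted:SelmerParityAtom`
and flag HardyLittlewoodConjE-strength statements summit-wide. SelmerParityLevel refuted only in the
EH range (m > x^{1/2}) ⇒ resplit as in the
two-layer plan, moving that range into the window crux. WindowWSub refuted ⇒ the n²+1 sieve frame
shared with QuadraticRoots is dead for both routes
(close; census names D). A grounder's proof that every Selmer-parity evaluation on the pencil
factors through local constants does not refute an
item but empties the mechanism ⇒ route to dormant unless a torsor-count formula (two-layer plan) is
produced. PolyMobiusTail / QrootsThesis proved
elsewhere moots the route.

NOT DECOMPOSED YET. The torsor-counting formula itself (which signed count of 2-coverings computes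
(−1)^{dim Sel₂ − 1} without local constants) — the mechanism's real
unknown, deliberately left as layer 2 under r3; the general Bateman–Horn system (a pencil with M_𝓔 =
f for each f; k ≥ 2); the rational-parameter
(two-variable) version where Helfgott's averages are unconditional for deg M ≤ 3; Mordell–Weil-rank
and Ш[2]-parity variants of r3 (conditional on
finiteness of Ш); constants q, K of the dictionary (a kit job fixes them); the large-sieve transfer
lemma of the two-layer plan.

CHEAPEST FALSIFIER. PARI, minutes: for t ≤ 2000 compute w_t = ellrootno(ellinit([0,2t,0,−1,0])),
ε(t) and λ(t²+1) and check that w_t·ε(t)·λ(t²+1) is a function of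
t mod 2^K for some K ≤ 8 (r4), that ellrootno(E,p) = −kronecker(t,p) at odd p ∣ t²+1, and that
Σ_{t≤x, t≡a (q)} w_t·[t²+1 squarefree] shows no
bias for q ≤ 16 (r3 via 2-parity). Planned as kit job `pencil-rootno` (script kit/rootno.gp in the
planner folder); NOT run: the compute socket was
absent on this hub at filing (operator). The reciprocity claim ∏_{p odd}(t|p)^{v_p(t²+1)} = f(t mod
8) was verified in plain Python for t ≤ 4000.

NUMBERS. Pencil invariants: Δ = 64(t²+1) (Lean-checked by `ring`), c₄ = 16(4t²+3), c₆ = −64t(8t²+9),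
j = 64(4t²+3)³/(t²+1); v₂(Δ) = 6 (t even) / 7 (t odd);
𝓔_t(ℚ)[2] = ℤ/2 for t ≥ 1; 2-isogenous curve y² = x³ − 4t x² + 4(t²+1)x. Fibres with ε(t) ≠ 1 (some
odd p² ∣ t²+1) have density 1 − ∏_{p≡1(4)}(1 − 2/p²) ≈ 0.10 (p = 5 alone: 0.08). Level needed by the
assembly: m ≤ x^{1−η} for the η of WindowWSub; large-sieve
range would be m ≤ x^{1/2−η}. Numerics on record: Σ_{n<N} μ(n²+1)/N = 0.017, 0.013, 0.0035, −0.0004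
at N = 5k…30k (refuter g3-1 on stmt-Parity-0615).
Items at open: 11 (target, 4 cruxes, 5 supports, assembly).

DEFINITION REQUESTS. None blocking (selmerCorank, rootNumber, p_parity, polyRootCountMod,
HardyLittlewoodConjE exist). Wanted Literature FACTS (cite requests filed after
open): (i) local root numbers of E/ℚ₂ with additive reduction (Kellock–Dokchitser 2023 §5 /
Halberstadt 1998 tables) — today `WeierstrassCurve.localRootNumber`
returns the junk value 0 there, so r4 is provable only through `exists_local_tables_two_three` plus
(ii) local constancy of local root numbers in
p-adic families (Helfgott2004RootNumberFamilies Prop. 4.2–4.3); (iii) Helfgott2003RootNumbers Prop.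
5.4 as a named fact would discharge r4 outright
once "pliable" is defined (not requested: periodic g is stated directly).

Novelty: Searches (2026-08-15): `lit search --source s2 "root numbers elliptic curves one-parameter families
average"` (15: Helfgott 2003/2004, Rizzo 1999,
Bettin–David–Delaunay 2016, Desjardins 2018, Chinis 2017, Diao arXiv:2608.10702, Miller et al. bias
papers); `lit search --source zbmath "root numbers
parity problem elliptic curves families Liouville polynomial"` (0); `lit search --hybrid "root
number elliptic surface family Liouville parity Helfgott"`
(vector noise only); `lit galaxy search "average root number" --star all` (18 rows, 1 relevant:
Bettin–David–Delaunay hal-01478267); `lit galaxy search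
"Selmer parity" / "root number Liouville elliptic surface" --star all` (0 each); openalex/arxiv legs
rate-limited (429) all session; `lit read
arxiv:math/0305435` (Prop. 5.1, 5.4, Lemma 5.2–5.3, Thm 7.1–7.4 read) and `arxiv:math/0408141`
(Prop. 4.2 read); card audit (refuter-novelty-audit-
Parity-BatemanHorn-1-0): zbMATH 'root number families elliptic curves parity' → Helfgott, Desjardins
2019, Conrad–Conrad–Helfgott 2005.
Nearest prior art found: Helfgott2003RootNumbers (arXiv:math/0305435, Prop. 5.4 + Thm 7.1:
Chowla(M_𝓔) ⇒ av W(𝓔(t)) = 0 — the FORWARD direction only);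
DokchitserDokchitserAnnals2010 Thm 1.4 (2-parity); BhargavaShankarAnnals2015 / arXiv:2503.17619
(Selmer statistics in LARGE families, parity handled
locally); Rizzo 1999, Bettin–David–Delaunay 2016, Desjardins 2018 (averages of root numbers in
families, all via local formulas).
Delta: nobody runs the dictionary backw  [refs: 2608.10702, math/0305435, math/0408141, 2503.17619, arxiv:math/0305435, arxiv:math/0408141, DokchitserDokchitserAnnals2010, BhargavaShankarAnnals2015]

Barriers (technique_class: selmer-parity root-number transfer, torsor-counting): - technique_class: selmer-parity root-number transfer, torsor-counting
- Literature.Barriers.Parity.FunctionFieldMobiusBias: consistent, not evaded by force — over 𝔽_q[u]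
the CCG bias lives in inseparable f and Helfgott's dictionary transports it faithfully
(constant-root-number families, Conrad–Conrad–Helfgott 2005); over ℤ every f is separable and X is
EQUIVALENT to Chowla for t²+1 by two theorems, so no false transfer of the local heuristic is used;
a genuine ℤ-analogue of the bias would refute r3 (kill criterion).
- Literature.Barriers.Parity.SelbergParityBarrier: evaded in kind — no Type-I sieve bound is asked
to produce primes; the parity content is isolated in r2/r3 as a statement about a global invariant
(Selmer corank), and the sieve frame (T1, r5) is used only for the parity-free ranges.
- Literature.Barriers.Parity.LargeSieveLevelHalf: it does not evade it; the bet is that uniformity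
in the conductor-part m ≤ x^{1−η} (EH range) comes from arithmetic structure of the pencil (torsor
counts vary algebraically with t), not from a large-sieve inequality — the two-layer plan isolates
the m ≤ x^{1/2−η} piece where the large sieve would suffice.
- Literature.Barriers.Parity.FordMaynardLowLevel: applies to Type-I/II prime-detecting sieves in the
thin set {n²+1}; the route detects no primes by Type II — its Type-II-like input is r5 (shared with
QuadraticRoots) and its parity input is r2; honest form: r5 does not evade the minimal-Type-II
width, it asks for it.
- Literature.B

History (route lifecycle, newest last):
- 2026-08-15T13:50:34Z · CLOSED retired — not-a-thesis: assembly does not conclude the sub-problem Statement (operator:999:1257524)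

sub-problem: BatemanHorn · status: closed(retired) · opened planner-plancard-Parity-BatemanHorn-selmer-pa-f7698059-0 2026-08-15T12:04:33Z · rev 0 · ledger route-Parity-SelmerParityReverse
GENERATED by the gate from the ledger (D-0016/17). Provers cite these decls: `theorem foo : Summit.Parity.BatemanHorn.Theses.SelmerParityReverse.<Decl> := …` in Summits/Parity/BatemanHorn/Theorems/<Name>.lean.
-/

namespace Summit.Parity.BatemanHorn.Theses.SelmerParityReverse

open scoped BigOperators Topology Manifold Classical MeasureTheory ProbabilityTheory Matrix InnerProductSpace ComplexConjugate ContinuousMap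
open Filter Set Function TopologicalSpace MeasureTheory

attribute [summit_statement] _root_.BatemanHorn

/-- item stmt-Parity-7167 · target · rank 0 · closed · moot by None · by planner
why it might fail: X_S is Chowla-in-APs for t²+1 at Elliott–Halberstam-range level in Selmer clothing; every unconditional Selmer-parity law in families so far factors through local root numbers (circularity), and the pencil is a thin (codimension-2) family in quartic-invariant space.
sources: Helfgott2003RootNumbers, DokchitserDokchitserAnnals2010, BhargavaShankarAnnals2015, arXiv:2503.17619, Teravainen2024
[target] X = SelmerParityLevel ∧ RootNumberDictionary (X_S ∧ X_D of the Thesis). -/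
@[route_item "route-Parity-SelmerParityReverse"]
def Target : Prop :=
  (∀ q₀ b : ℕ, 0 < q₀ → ∀ η : ℝ, 0 < η → η < 1 → ∀ A : ℝ, 0 < A → ∃ x₀ : ℕ, ∀ x : ℕ, x₀ ≤ x → ∀ y : ℕ → ℕ → ℕ, (∀ m ρ, y m ρ ≤ x) → ∑ m ∈ Finset.Icc 1 ⌊(x : ℝ) ^ (1 - η)⌋₊, ∑ ρ ∈ (Finset.range m).filter (fun ρ => m ∣ ρ ^ 2 + 1), |∑ t ∈ (Finset.Icc 1 (y m ρ)).filter (fun t => t ≡ ρ [MOD m] ∧ t ≡ b [MOD q₀]), (((∏ p ∈ (t ^ 2 + 1).primeFactors.erase 2, (-1 : ℤ) ^ (padicValNat p (t ^ 2 + 1) + 1) * jacobiSym (t : ℤ) p ^ (padicValNat p (t ^ 2 + 1) - 1)) * (-1 : ℤ) ^ (WeierstrassCurve.selmerCorank (⟨0, 2 * (t : ℚ), 0, -1, 0⟩ : WeierstrassCurve ℚ) 2) : ℤ) : ℝ)| ≤ (x : ℝ) / Real.log x ^ A) ∧ (∃ q : ℕ, 0 < q ∧ ∃ g : ℕ → ℤ,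 (∀ t, g (t + q) = g t) ∧ (∀ t, g t = 1 ∨ g t = -1) ∧ ∀ t : ℕ, 1 ≤ t → WeierstrassCurve.rootNumber (⟨0, 2 * (t : ℚ), 0, -1, 0⟩ : WeierstrassCurve ℚ) = g t * (∏ p ∈ (t ^ 2 + 1).primeFactors.erase 2, (-1 : ℤ) ^ (padicValNat p (t ^ 2 + 1) + 1) * jacobiSym (t : ℤ) p ^ (padicValNat p (t ^ 2 + 1) - 1)) * (-1 : ℤ) ^ (ArithmeticFunction.cardFactors (t ^ 2 + 1)))

/-- item stmt-Parity-7168 · crux · rank 2 · closed · moot by None · by planner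
why it might fail: Equivalent (given r4 + 2-parity) to level-(1−η) equidistribution of λ(t²+1) on root classes: parity atom AND EH-range uniformity in m (LargeSieveLevelHalf); known Selmer laws (Heath-Brown, Kane, Smith, Bhargava–Shankar) need large families and compute parity locally.
sources: Helfgott2003RootNumbers, DokchitserDokchitserAnnals2010, BhargavaShankarAnnals2015, PoonenRains2012, arXiv:2503.17619, Literature.Barriers.Parity.LargeSieveLevelHalf
[crux] for every fixed auxiliary class t ≡ b (mod q₀), every η ∈ (0,1) and A > 0, for x ≥ x₀: Σ_{m ≤
x^{1−η}} Σ_{ρ mod m, m∣ρ²+1} max_{y ≤ x} |Σ_{t ≤ y, t≡ρ (m), t≡b (q₀)} ε(t)(−1)^{corank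
Sel_2∞(𝓔_t)}| ≤ x/(log x)^A — the ε-normalised Selmer parity of the pencil is equidistributed along
its multiplicative fibres (m ∣ t²+1 ⇔ 𝓔_t multiplicative at all p ∣ m), uniformly for
conductor-parts m ≤ x^{1−η} (card C1+C2, level form needed by the assembly). [difficulty:
open-problem] -/
@[route_item "route-Parity-SelmerParityReverse"]
def SelmerParityLevel : Prop :=
  ∀ q₀ b : ℕ, 0 < q₀ → ∀ η : ℝ, 0 < η → η < 1 → ∀ A : ℝ, 0 < A → ∃ x₀ : ℕ, ∀ x : ℕ, x₀ ≤ x → ∀ y : ℕ → ℕ → ℕ, (∀ m ρ, y m ρ ≤ x) → ∑ m ∈ Finset.Icc 1 ⌊(x : ℝ) ^ (1 - η)⌋₊, ∑ ρ ∈ (Finset.range m).filter (fun ρ => m ∣ ρ ^ 2 + 1), |∑ t ∈ (Finset.Icc 1 (y m ρ)).filter (fun t => t ≡ ρ [MOD m] ∧ t ≡ b [MOD q₀]), (((∏ p ∈ (t ^ 2 + 1).primeFactors.erase 2, (-1 : ℤ) ^ (padicValNat p (t ^ 2 + 1) + 1) * jacobiSym (t : ℤ) p ^ (padicValNat p (t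 ^ 2 + 1) - 1)) * (-1 : ℤ) ^ (WeierstrassCurve.selmerCorank (⟨0, 2 * (t : ℚ), 0, -1, 0⟩ : WeierstrassCurve ℚ) 2) : ℤ) : ℝ)| ≤ (x : ℝ) / Real.log x ^ A

/-- item stmt-Parity-7169 · crux · rank 3 · closed · moot by None · by planner
why it might fail: As a Möbius statement it is polynomial Chowla for (qm+a)²+1, open for every nonlinear polynomial (Teravainen2024 Conj. 1.2); as a Selmer statement no root-number-free evaluation of parity in a thin pencil is known — a grounder may show every available formula is Cassels/DD-local, i.e. circular.
sources: Teravainen2024, Chowla1965, Helfgott2003RootNumbers, DokchitserDokchitserAnnals2010, Monsky1996, PoonenRains2012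
[crux] for every q ≥ 1 and a: Σ_{t ≤ x, t ≡ a (q), t²+1 squarefree} (−1)^{corank Sel_2∞(𝓔_t)} = o(x)
— 2^∞-Selmer parity (equivalently rank parity given Ш(𝓔_t)[2^∞] finite, or dim Sel₂(𝓔_t) − 1 mod 2
by Cassels–Tate) of the pencil is equidistributed in every arithmetic progression of squarefree
fibres; by r4 + 2-parity this is literally Σ_{t≡a (q)} μ(t²+1) = o(x) for all q, a (the Möbius atom
of n²+1 in APs, cf. stmt-Parity-0650 e = 1 and stmt-Parity-0615): the card's headline equivalence,
the first target for any torsor-counting engine and the cheapest statement to test. [difficulty: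
open-problem] -/
@[route_item "route-Parity-SelmerParityReverse"]
def SelmerParityAtom : Prop :=
  ∀ q a : ℕ, 0 < q → (fun x : ℕ => ∑ t ∈ (Finset.Icc 1 x).filter (fun t => t ≡ a [MOD q] ∧ Squarefree (t ^ 2 + 1)), (-1 : ℝ) ^ (WeierstrassCurve.selmerCorank (⟨0, 2 * (t : ℚ), 0, -1, 0⟩ : WeierstrassCurve ℚ) 2)) =o[atTop] fun x : ℕ => (x : ℝ)

/-- item stmt-Parity-7170 · crux · rank 4 · closed · moot by None · by planner
why it might fail: PERIODICITY of g is the bet: Helfgott's g is only pliable (may depend on v₂(t)); here v₂(c₆) = 6+v₂(t) is unbounded while v₂(Δ) ≤ 7, and w₂ must be read off Kellock–Dokchitser's ℚ₂ tables — a slip there or in the split criterion flips signs (PARI ellrootno settles it).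
sources: Helfgott2003RootNumbers, Helfgott2004RootNumberFamilies, Rohrlich1993Compositio, KellockDokchitser2023, Literature.NumberTheory.EllipticCurves.exists_local_tables_two_three
[crux] there are q ≥ 1 and a q-periodic g : ℕ → {±1} with w(𝓔_t) = g(t)·ε(t)·λ(t²+1) for all t ≥ 1
(Helfgott's Prop. 5.4 made explicit for the pencil: w_∞ = −1; w_p = −(t|p) at odd p ∣ t²+1 since the
node of y² = x(x+t)² mod p has tangent cone y² = −tX² and p ≡ 1 (4); ∏_p (t|p)^{v_p(t²+1)} depends
on t mod 8; w_2(𝓔_t) depends on t mod 2^K because v₂(Δ) ∈ {6,7} is bounded and local root numbers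
are locally constant 2-adically). [difficulty: M] -/
@[route_item "route-Parity-SelmerParityReverse"]
def RootNumberDictionary : Prop :=
  ∃ q : ℕ, 0 < q ∧ ∃ g : ℕ → ℤ, (∀ t, g (t + q) = g t) ∧ (∀ t, g t = 1 ∨ g t = -1) ∧ ∀ t : ℕ, 1 ≤ t → WeierstrassCurve.rootNumber (⟨0, 2 * (t : ℚ), 0, -1, 0⟩ : WeierstrassCurve ℚ) = g t * (∏ p ∈ (t ^ 2 + 1).primeFactors.erase 2, (-1 : ℤ) ^ (padicValNat p (t ^ 2 + 1) + 1) * jacobiSym (t : ℤ) p ^ (padicValNat p (t ^ 2 + 1) - 1)) * (-1 : ℤ) ^ (ArithmeticFunction.cardFactors (t ^ 2 + 1))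

/-- item stmt-Parity-7171 · crux · rank 5 · closed · moot by None · by planner
why it might fail: For d > x it is μ(d) against counts of SMALL roots ν ≤ x of ν² ≡ −1 (d): Type-II information for A_{mn} in print stops at n < x^{1/3} (arXiv:2505.00493 Thm 1.5; Merikoski2022 Prop. 4); the balanced range mn ~ x is the spectral method's diagonal.
sources: Merikoski2022, arXiv:2505.00493, DukeFriedlanderIwaniec1995, Hooley1976, stmt-Parity-0648
[crux] SUB-DYADIC parity window for n²+1: ∃ η > 0 ∀ A: for all large x and x^{1−η} ≤ D ≤ D′ ≤ 2D, D
≤ x^{1+η}: |Σ_{D<d≤D′} μ(d)(#{n ≤ x : d ∣ n²+1} − x·ω(d)/d)| ≤ x/(log x)^A (ω = polyRootCountMod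
(X²+1)); D′ = 2D is QuadraticRoots' (W) = stmt-Parity-0648, and the sub-dyadic form is what partial
summation of the log-weights actually needs (refuter note g2-1 on stmt-Parity-0647). [difficulty:
open-problem] -/
@[route_item "route-Parity-SelmerParityReverse"]
def WindowWSub : Prop :=
  ∃ η : ℝ, 0 < η ∧ ∀ A : ℝ, 0 < A → ∃ x₀ : ℝ, ∀ x D D' : ℝ, x₀ ≤ x → x ^ (1 - η) ≤ D → D ≤ D' → D' ≤ 2 * D → D ≤ x ^ (1 + η) → |∑ d ∈ Finset.Ioc ⌊D⌋₊ ⌊D'⌋₊, (ArithmeticFunction.moebius d : ℝ) * (((((Finset.Icc 1 ⌊x⌋₊).filter (fun n : ℕ => d ∣ n ^ 2 + 1)).card : ℕ) : ℝ) - x * (Literature.NumberTheory.Sieve.polyRootCountMod ![(Polynomial.X ^ 2 + 1 : Polynomial ℤ)] d : ℝ) / d)| ≤ x / Real.log x ^ A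

/-- item stmt-Parity-0651 · support · rank 9 · open · by planner
sources: Hooley1976, stmt-Parity-0651
(T1), grounding and PROVABLE: for every ε, A > 0, ∑_{d ≤ x^{1-ε}} |#{n ≤ x : d ∣ n²+1} - x ω(d)/d| ≪
x/(log x)^A, since each remainder is O(ω(d)) (complete residue systems) and ∑_{d ≤ D} ω(d) ≪ D log D
with D = x^{1-ε}. -/
@[route_item "route-Parity-SelmerParityReverse"]
def QrootsTypeIT1 : Prop :=
  ∀ ε A : ℝ, 0 < ε → 0 < A → (fun x : ℝ => ∑ d ∈ Finset.Icc 1 ⌊x ^ (1 - ε)⌋₊, |((((Finset.Icc 1 ⌊x⌋₊).filter (fun n : ℕ => d ∣ n ^ 2 + 1)).card : ℕ) : ℝ) - x * (Literature.NumberTheory.Sieve.polyRootCountMod ![(Polynomial.X ^ 2 + 1 : Polynomial ℤ)] d : ℝ) / d|) =O[Filter.atTop] fun x : ℝ => x / Real.log x ^ A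

/-- item stmt-Parity-7172 · support · rank 9 · closed · moot by None · by planner
sources: Chowla1965, Teravainen2024, Helfgott2003RootNumbers, stmt-Parity-0649
[support] λ-side junction (implied by r2 ∧ r4 ∧ 2-parity via SelmerToLiouville; stated separately so
that the bookkeeping item is purely λ-side): ∀ η ∈ (0,1) ∀ A: Σ_{m ≤ x^{1−η}} Σ_{ρ mod m, m∣ρ²+1}
max_{y≤x} |Σ_{t ≤ y, t ≡ ρ (m)} λ(t²+1)| ≤ x/(log x)^A for x ≥ x₀. Itself open (contains Σ λ(n²+1) =
o(x), Chowla 1965; Helfgott's Hypothesis 𝔅₁(t²+1) is its level-(log x)^A case). [difficulty: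
open-problem] -/
@[route_item "route-Parity-SelmerParityReverse"]
def LiouvilleRootClassLevel : Prop :=
  ∀ η : ℝ, 0 < η → η < 1 → ∀ A : ℝ, 0 < A → ∃ x₀ : ℕ, ∀ x : ℕ, x₀ ≤ x → ∀ y : ℕ → ℕ → ℕ, (∀ m ρ, y m ρ ≤ x) → ∑ m ∈ Finset.Icc 1 ⌊(x : ℝ) ^ (1 - η)⌋₊, ∑ ρ ∈ (Finset.range m).filter (fun ρ => m ∣ ρ ^ 2 + 1), |∑ t ∈ (Finset.Icc 1 (y m ρ)).filter (fun t => t ≡ ρ [MOD m]), (-1 : ℝ) ^ (ArithmeticFunction.cardFactors (t ^ 2 + 1))| ≤ (x : ℝ) / Real.log x ^ A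

/-- item stmt-Parity-7173 · support · rank 9 · closed · moot by None · by planner
sources: BatemanHorn1962, Hooley1976, Literature.NumberTheory.Sieve.tendsto_hardyLittlewoodE_partial
[support] the two PNT(ℚ(i))-grade singular-series inputs the bookkeeping needs and QuadraticRoots
left implicit (refuter note g2-7 on stmt-Parity-0647): (a) Σ_{d≤D} μ(d)ω(d)/d ≪_A (log D)^{−A}; (b)
Σ_{d≤D} μ(d)ω(d) log d/d → −𝔖, 𝔖 = hardyLittlewoodEConst = ∏_p (1−ω(p)/p)(1−1/p)^{−1} (Dirichlet
series ∏_p(1 − ω(p)p^{−1−s}) ~ s·𝔖 at s = 0; zero-free region of ζ_{ℚ(i)}). [difficulty: L] -/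
@[route_item "route-Parity-SelmerParityReverse"]
def SingularSeriesPNT : Prop :=
  (∀ A : ℝ, 0 < A → ∃ C : ℝ, ∀ D : ℕ, 2 ≤ D → |∑ d ∈ Finset.Icc 1 D, (ArithmeticFunction.moebius d : ℝ) * (Literature.NumberTheory.Sieve.polyRootCountMod ![(Polynomial.X ^ 2 + 1 : Polynomial ℤ)] d : ℝ) / d| ≤ C / Real.log D ^ A) ∧ Tendsto (fun D : ℕ => ∑ d ∈ Finset.Icc 1 D, (ArithmeticFunction.moebius d : ℝ) * (Literature.NumberTheory.Sieve.polyRootCountMod ![(Polynomial.X ^ 2 + 1 : Polynomial ℤ)] d : ℝ) * Real.log d / d) atTop (𝓝 (-Literature.NumberTheory.Sieve.hardyLittlewoodEConst))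

/-- item stmt-Parity-7174 · support · rank 9 · closed · moot by None · by planner
sources: DokchitserDokchitserAnnals2010, Helfgott2003RootNumbers
[support] glue, provable now: SelmerParityLevel → RootNumberDictionary → (2-parity for all E/ℚ, the
Literature fact p_parity as hypothesis) → LiouvilleRootClassLevel. Proof: Δ(𝓔_t) = 64(t²+1) ≠ 0
gives IsElliptic; λ(t²+1) = g(t)·ε(t)·(−1)^{corank} (all factors ±1); split t by its class b mod q
(period of g), apply r2 with (q₀,b) = (q,b) and η/2, sum the q bounds. [difficulty: provable-now] -/
@[route_item "route-Parity-SelmerParityReverse"]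
def SelmerToLiouville : Prop :=
  SelmerParityLevel → RootNumberDictionary → (∀ (W : WeierstrassCurve ℚ) [W.IsElliptic] (p : ℕ) [Fact p.Prime], Literature.NumberTheory.EllipticCurves.p_parity W p) → LiouvilleRootClassLevel

/-- item stmt-Parity-7175 · support · rank 9 · closed · moot by None · by planner
sources: Hooley1976, BatemanHorn1962, stmt-Parity-0647
[support] λ-side bookkeeping, provable with effort: LiouvilleRootClassLevel → WindowWSub →
QrootsTypeIT1 → SingularSeriesPNT → tendsto_hardyLittlewoodE_partial → HardyLittlewoodConjE. Σ_{n≤x}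
Λ(n²+1) = −Σ_n Σ_{d∣n²+1} μ(d) log d; d ≤ x^{1−η}: (T1) + SingularSeriesPNT(b) give 𝔖x + o(x);
x^{1−η} < d ≤ x^{1+η}: WindowWSub with log d by partial summation inside each dyadic block plus
SingularSeriesPNT(a) for the main terms; d > x^{1+η} ⇔ e = (n²+1)/d < x^{1−η}: μ(d) =
λ(e)λ(n²+1)·Σ_{r²∣d} μ(r) (λ completely multiplicative), r ≤ x^{η/4}: root classes mod e·r² ≤
x^{1−η/2} with the length cut n² + 1 > e x^{1+η} absorbed by max_y — LiouvilleRootClassLevel at η/2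
once per r; r > x^{η/4}: ≤ x^ε·#{n ≤ x : ∃ r > x^{η/4}, r² ∣ n²+1} ≪ x^{1−η/5} (Estermann: Σ_{r ≤
x^{2/3}}(xω(r²)/r² + ω(r²)) + O(log x) Pell solutions per c ≤ x^{2/3}); then prime powers n²+1 =
p^k, k ≥ 3, are O(x^{2/3}), partial summation to the count, HardyLittlewoodConjE.isEquivalent-form
with 𝔖. [difficulty: L] -/
@[route_item "route-Parity-SelmerParityReverse"]
def LiouvilleToHLE : Prop :=
  LiouvilleRootClassLevel → WindowWSub → QrootsTypeIT1 → SingularSeriesPNT → Literature.NumberTheory.Sieve.tendsto_hardyLittlewoodE_partial → Literature.NumberTheory.Sieve.HardyLittlewoodConjE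

/-- item stmt-Parity-7176 · assembly · rank 1 · closed · moot by None · by planner
sources: Helfgott2003RootNumbers, DokchitserDokchitserAnnals2010, BatemanHorn1962
[assembly] SelmerParityLevel → RootNumberDictionary → (∀ E/ℚ elliptic, ∀ p, p_parity E p) →
WindowWSub → QrootsTypeIT1 → SingularSeriesPNT → tendsto_hardyLittlewoodE_partial →
HardyLittlewoodConjE. -/
@[route_item "route-Parity-SelmerParityReverse"]
def Assembly : Prop :=
  SelmerParityLevel → RootNumberDictionary → (∀ (W : WeierstrassCurve ℚ) [W.IsElliptic] (p : ℕ) [Fact p.Prime], Literature.NumberTheory.EllipticCurves.p_parity W p) → WindowWSub → QrootsTypeIT1 → SingularSeriesPNT → Literature.NumberTheory.Sieve.tendsto_hardyLittlewoodE_partial → Literature.NumberTheory.Sieve.HardyLittlewoodConjE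

end Summit.Parity.BatemanHorn.Theses.SelmerParityReverse
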